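import Mathlib
import Literature.MathematicalPhysics.QuantumLattice.WilsonDiracAP
import Literature.MathematicalPhysics.QuantumLattice.SymbolCertificate
import Summits.QuantumFields.QCD.Theorems.QuarksAsStableActionWilsonQuarkStabilityTangentLinearKernel
import Summits.QuantumFields.QCD.Theorems.QuarksAsStableActionCriticalLineDiamagnetismStubBlockHessianFormulaAux

/-!
# Momentum blocks of the hopping perturbation, Parseval, and the tadpole spin trace
(helper for crux stmt-QuantumFields-9734, line `Sketch`, stub `stub_blockHessianFormula`; aux stub
`stub_blockHessianFormulaAuxB`)

What.  On the `2⁴` block `(ℤ/2)⁴` with constant central link phases `u_μ = e^{iθ_μ}·1`, the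
hopping perturbation `Δ(E)` (forward hop `(1 − γ_μ) ⊗ u_μ E(x,μ)`, backward hop
`(1 + γ_μ) ⊗ (u_μ E(y,μ))ᴴ`) has the momentum blocks
`Δ̂(E)(k,k') = Σ_ν [ −½ e^{iP_{k'}ν} Ê_ν(k+k') ⊗ (1 − γ_ν) − ½ e^{−iP_k ν} Ê_ν(k+k')ᴴ ⊗ (1 + γ_ν) ]`
in the real plane-wave basis `χ_s(x) = (−1)^{s·x}` (`Ê_ν(t) = Σ_x χ_t(x) E(x,ν)` the Walsh transform,
`P_k = θ + πk` the block momenta): `BlockHessianFormula.hat_hop`, `stub_blockHessianFormulaAuxB`.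
Also: Parseval `Σ_s Ê_μ(s)ᴴ Ê_μ(s) = 16 Σ_x E(x,μ)ᴴ E(x,μ)` (`parseval`) and the tadpole spin trace
`tr (S(P) · (−½ e^{iP_ν}(1 − γ_ν) − ½ e^{−iP_ν}(1 + γ_ν))) = 4 (sin² P_ν − M_W cos P_ν)/h`
for the free propagator `S = (M_W − iΣ sin P_κ γ_κ)/h` (`trace_symbolInv_mul_hop`); and the generic
bookkeeping of the assembly (`sum_reindex` by the Walsh transfer `s = k + k'`, colour ⊗ spin trace
factorisation `trace_kron_one/two`, real parts `re_bubble_bookkeeping`, `re_tadpole_bookkeeping`).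

How.  Entrywise evaluation of the Kronecker-delta hops against the characters
(`χ_{k'}(y + e_ν) = χ_{k'}(y) χ_{k'}(e_ν)`, `χ_k χ_{k'} = χ_{k+k'}` — `LaurentSymbol.torusChar_add_left` —,
`e^{iθ_ν} χ_k(e_ν) = e^{iP_k ν}`), character
orthogonality `Σ_s χ_s(x) χ_s(x') = 16 δ_{xx'}`, and `tr γ_ν = 0`, `tr γ_κ γ_ν = 4δ_{κν}`.

References: Montvay–Münster, *Quantum Fields on a Lattice* §4.2 (Wilson fermions, hopping expansion in
momentum space); folklore.  Pure theorem file (no `def`s).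
-/

noncomputable section

open scoped BigOperators Classical Matrix ComplexConjugate
open Finset
open Literature.MathematicalPhysics.QuantumLattice Literature.MathematicalPhysics.QuantumFieldTheory
  Literature.Probability.LatticeModels

namespace Summit.QuantumFields.QCD.Cruxes.CriticalLineDiamagnetism.ChessboardCellGain

open scoped Kronecker
open Complex (I)
open Summit.QuantumFields.QCD.Cruxes.WilsonQuarkStability.FreeTangentLandauChessboard

namespace BlockHessianFormula

/-! ### Characters -/

/-- Character orthogonality on `(ℤ/2)⁴` in the real form: `Σ_s χ_s(x) χ_s(x') = 16 δ_{x x'}`. -/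
theorem sum_torusChar_mul_two (x x' : TorusSite 4 2) :
    ∑ s, torusChar s x * torusChar s x' = if x = x' then (16 : ℂ) else 0 := by
  simp_rw [← torusChar_add_right]
  rw [sum_torusChar_left]
  have hx : x + x' = 0 ↔ x = x' := by
    constructor
    · intro h
      rw [← add_add_cancel_left x x', h, add_zero]
    · intro h
      rw [h]
      have h0 := add_add_cancel_left x' 0
      rwa [add_zero] at h0
  simp only [hx]
  norm_num

/-! ### Parseval for the Walsh transform of a matrix-valued link field -/

/-- **Parseval**: `Σ_s Ê_μ(s)ᴴ Ê_μ(s) = 16 Σ_x E(x,μ)ᴴ E(x,μ)` for the Walsh transform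
`Ê_μ(s) = Σ_x χ_s(x) E(x,μ)` with the real signs `χ_s(x) = (−1)^{s·x}`. -/
theorem parseval (chi : (Fin 4 → ZMod 2) → TorusSite 4 2 → ℝ)
    (Yh : (Edge 4 2 → Matrix (Fin 3) (Fin 3) ℂ) → (Fin 4 → ZMod 2) → Fin 4 → Matrix (Fin 3) (Fin 3) ℂ)
    (hchi : ∀ s x, chi s x = (-1 : ℝ) ^ (∑ κ, (s κ).val * (x κ).val))
    (hYh : ∀ E s μ, Yh E s μ = ∑ x, ((chi s x : ℝ) : ℂ) • E (x, μ))
    (E : Edge 4 2 → Matrix (Fin 3) (Fin 3) ℂ) (μ : Fin 4) :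
    ∑ s, (Yh E s μ)ᴴ * Yh E s μ = (16 : ℂ) • ∑ x, (E (x, μ))ᴴ * E (x, μ) := by
  have hct : ∀ s x, ((chi s x : ℝ) : ℂ) = torusChar s x := fun s x => by rw [torusChar_two, hchi]
  have hH : ∀ s, (Yh E s μ)ᴴ = ∑ x, ((chi s x : ℝ) : ℂ) • (E (x, μ))ᴴ := fun s => by
    rw [hYh, Matrix.conjTranspose_sum]
    simp only [Matrix.conjTranspose_smul, Complex.star_def, Complex.conj_ofReal]
  simp_rw [hH, hYh, hct, Matrix.sum_mul, Matrix.mul_sum, Matrix.smul_mul, Matrix.mul_smul, smul_smul]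
  rw [Finset.sum_comm]
  refine (Finset.sum_congr rfl fun x _ => Finset.sum_comm).trans ?_
  simp_rw [← Finset.sum_smul, sum_torusChar_mul_two, ite_smul, zero_smul, Finset.sum_ite_eq,
    Finset.mem_univ, if_true, Finset.smul_sum]

/-! ### The tadpole spin trace -/

/-- `tr ((w·1 − iΣ s_κ γ_κ)(a(1 − γ_ν) + b(1 + γ_ν))) = a(4w + 4i s_ν) + b(4w − 4i s_ν)`. -/
theorem trace_symbolAdj_mul (w : ℝ) (s : Fin 4 → ℝ) (ν : Fin 4) (a b : ℂ) :
    ((((w : ℂ) • (1 : Matrix (Fin 4) (Fin 4) ℂ) - I • ∑ κ, ((s κ : ℝ) : ℂ) • euclideanGamma κ)) *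
        (a • ((1 : Matrix (Fin 4) (Fin 4) ℂ) - euclideanGamma ν) +
          b • ((1 : Matrix (Fin 4) (Fin 4) ℂ) + euclideanGamma ν))).trace =
      a * (4 * w + 4 * I * s ν) + b * (4 * w - 4 * I * s ν) := by
  have htrSγ : ((∑ κ, ((s κ : ℝ) : ℂ) • euclideanGamma κ) * euclideanGamma ν).trace = 4 * s ν := by
    simp only [Matrix.sum_mul, Matrix.smul_mul, Matrix.trace_sum, Matrix.trace_smul,
      trace_euclideanGamma_mul, smul_eq_mul, mul_ite, mul_zero, Finset.sum_ite_eq',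
      Finset.mem_univ, if_true]
    ring
  have htrS : (∑ κ, ((s κ : ℝ) : ℂ) • euclideanGamma κ).trace = 0 := by
    simp [Matrix.trace_sum, Matrix.trace_smul, trace_euclideanGamma']
  simp only [Matrix.mul_add, Matrix.mul_smul, Matrix.sub_mul, Matrix.mul_sub, Matrix.smul_mul,
    Matrix.one_mul, Matrix.mul_one, Matrix.trace_add, Matrix.trace_smul, Matrix.trace_sub,
    Matrix.trace_one, Fintype.card_fin, trace_euclideanGamma', htrS, htrSγ, smul_eq_mul]
  push_cast
  ring

/-- **The tadpole spin trace**: for the free propagator `S = (w·1 − iΣ_κ sin P_κ γ_κ)/h`,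
`tr (S · (−½ e^{iP_ν}(1 − γ_ν) − ½ e^{−iP_ν}(1 + γ_ν))) = 4 (sin² P_ν − w cos P_ν)/h`. -/
theorem trace_symbolInv_mul_hop (w h : ℝ) (P : Fin 4 → ℝ) (ν : Fin 4) :
    ((((h : ℝ) : ℂ)⁻¹ • (((w : ℝ) : ℂ) • (1 : Matrix (Fin 4) (Fin 4) ℂ) -
        I • ∑ κ, ((Real.sin (P κ) : ℝ) : ℂ) • euclideanGamma κ)) *
      ((-(1 / 2 : ℂ) * Complex.exp (↑(P ν) * I)) • ((1 : Matrix (Fin 4) (Fin 4) ℂ) - euclideanGamma ν) +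
        (-(1 / 2 : ℂ) * Complex.exp (-(↑(P ν) * I))) •
          ((1 : Matrix (Fin 4) (Fin 4) ℂ) + euclideanGamma ν))).trace =
      ((4 * (Real.sin (P ν) ^ 2 - w * Real.cos (P ν)) / h : ℝ) : ℂ) := by
  rw [Matrix.smul_mul, Matrix.trace_smul, trace_symbolAdj_mul w (fun κ => Real.sin (P κ)) ν, smul_eq_mul,
    show -(↑(P ν) * I) = -↑(P ν) * I by ring, ← Complex.cos_sub_sin_I, Complex.exp_mul_I]
  push_cast
  linear_combination (-4 * ((h : ℂ))⁻¹ * (Complex.sin ↑(P ν)) ^ 2) * Complex.I_sq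

/-! ### Momentum blocks of the hopping perturbation -/

section Hop

variable (θ : Fin 4 → ℝ) (u : Fin 4 → Matrix.unitaryGroup (Fin 3) ℂ)
  (Dl : (Edge 4 2 → Matrix (Fin 3) (Fin 3) ℂ) →
    Matrix (TorusSite 4 2 × Fin 3 × Fin 4) (TorusSite 4 2 × Fin 3 × Fin 4) ℂ)
  (mom : (Fin 4 → ZMod 2) → Fin 4 → ℝ) (chi : (Fin 4 → ZMod 2) → TorusSite 4 2 → ℝ)
  (Yh : (Edge 4 2 → Matrix (Fin 3) (Fin 3) ℂ) → (Fin 4 → ZMod 2) → Fin 4 → Matrix (Fin 3) (Fin 3) ℂ)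
  (hat : Matrix (TorusSite 4 2 × Fin 3 × Fin 4) (TorusSite 4 2 × Fin 3 × Fin 4) ℂ →
    (Fin 4 → ZMod 2) → (Fin 4 → ZMod 2) → Matrix (Fin 3 × Fin 4) (Fin 3 × Fin 4) ℂ)

/-- **Momentum blocks of the hopping perturbation** `Δ(E)` in the real plane-wave basis:
`Δ̂(E)(k,k') = Σ_ν [ −½ e^{iP_{k'}ν} Ê_ν(k+k') ⊗ (1 − γ_ν) − ½ e^{−iP_k ν} Ê_ν(k+k')ᴴ ⊗ (1 + γ_ν) ]`
(the forward hop carries the plane wave `χ_{k'}` across the link and picks up `e^{iθ_ν} χ_{k'}(e_ν) = e^{iP_{k'}ν}`,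
the backward hop picks up `e^{−iθ_ν} χ_k(e_ν) = e^{−iP_k ν}`; the product `χ_k χ_{k'} = χ_{k+k'}` is the
Walsh momentum transfer). -/
theorem hat_hop
    (hu : ∀ μ, (u μ : Matrix (Fin 3) (Fin 3) ℂ) = Complex.exp (↑(θ μ) * I) • (1 : Matrix (Fin 3) (Fin 3) ℂ))
    (hDl : ∀ E, Dl E = Matrix.of fun p q : TorusSite 4 2 × Fin 3 × Fin 4 => -(1 / 2 : ℂ) * ∑ μ : Fin 4,
      ((if q.1 = Site.shift p.1 μ then ((1 : Matrix (Fin 4) (Fin 4) ℂ) - euclideanGamma μ) p.2.2 q.2.2 *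
          ((u μ : Matrix (Fin 3) (Fin 3) ℂ) * E (p.1, μ)) p.2.1 q.2.1 else 0) +
        (if p.1 = Site.shift q.1 μ then ((1 : Matrix (Fin 4) (Fin 4) ℂ) + euclideanGamma μ) p.2.2 q.2.2 *
          ((u μ : Matrix (Fin 3) (Fin 3) ℂ) * E (q.1, μ))ᴴ p.2.1 q.2.1 else 0)))
    (hmom : ∀ s κ, mom s κ = θ κ + Real.pi * ((s κ).val : ℝ))
    (hchi : ∀ s x, chi s x = (-1 : ℝ) ^ (∑ κ, (s κ).val * (x κ).val))
    (hYh : ∀ E s μ, Yh E s μ = ∑ x, ((chi s x : ℝ) : ℂ) • E (x, μ))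
    (hhat : ∀ A k k', hat A k k' =
      ∑ y, ∑ z, ((chi k y * chi k' z : ℝ) : ℂ) • Matrix.of fun c c' : Fin 3 × Fin 4 => A (y, c) (z, c'))
    (E : Edge 4 2 → Matrix (Fin 3) (Fin 3) ℂ) (k k' : Fin 4 → ZMod 2) :
    hat (Dl E) k k' = ∑ ν, ((-(1 / 2 : ℂ) * Complex.exp (↑(mom k' ν) * I)) •
        (Yh E (k + k') ν ⊗ₖ ((1 : Matrix (Fin 4) (Fin 4) ℂ) - euclideanGamma ν)) +
      (-(1 / 2 : ℂ) * Complex.exp (-(↑(mom k ν) * I))) •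
        ((Yh E (k + k') ν)ᴴ ⊗ₖ ((1 : Matrix (Fin 4) (Fin 4) ℂ) + euclideanGamma ν))) := by
  have hct : ∀ s x, ((chi s x : ℝ) : ℂ) = torusChar s x := fun s x => by rw [torusChar_two, hchi]
  have hθ' : ∀ v t : ℝ, 2 * Real.pi * v / ((2 : ℕ) : ℝ) + t = t + Real.pi * v := fun v t => by
    push_cast; ring
  have hreal : ∀ (s : Fin 4 → ZMod 2) (x : TorusSite 4 2), conj (torusChar s x) = torusChar s x :=
    fun s x => by rw [← hct, Complex.conj_ofReal]
  -- the phases picked up by a hop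
  have hfw : ∀ (s : Fin 4 → ZMod 2) (ν : Fin 4),
      Complex.exp (↑(θ ν) * I) * torusChar s (Pi.single ν 1) = Complex.exp (↑(mom s ν) * I) := by
    intro s ν
    rw [exp_mul_torusChar_single, hθ', hmom, Complex.exp_mul_I, ← Complex.ofReal_cos,
      ← Complex.ofReal_sin]
  have hbw : ∀ (s : Fin 4 → ZMod 2) (ν : Fin 4),
      star (Complex.exp (↑(θ ν) * I)) * torusChar s (Pi.single ν 1) =
        Complex.exp (-(↑(mom s ν) * I)) := by
    intro s ν
    rw [← hreal, Complex.star_def, ← Complex.exp_conj, map_mul, Complex.conj_ofReal, Complex.conj_I,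
      mul_neg, exp_neg_mul_conj_torusChar_single, hθ', hmom, Complex.ofReal_cos, Complex.ofReal_sin,
      Complex.cos_sub_sin_I, neg_mul]
  -- colour factors
  have hu' : ∀ ν x, (u ν : Matrix (Fin 3) (Fin 3) ℂ) * E (x, ν) = Complex.exp (↑(θ ν) * I) • E (x, ν) :=
    fun ν x => by rw [hu, Matrix.smul_mul, Matrix.one_mul]
  have hYhH : ∀ s ν, (Yh E s ν)ᴴ = ∑ x, ((chi s x : ℝ) : ℂ) • (E (x, ν))ᴴ := fun s ν => by
    rw [hYh, Matrix.conjTranspose_sum]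
    simp only [Matrix.conjTranspose_smul, Complex.star_def, Complex.conj_ofReal]
  have hadd : ∀ (M N : Matrix (Fin 3 × Fin 4) (Fin 3 × Fin 4) ℂ) (i j : Fin 3 × Fin 4),
      (M + N) i j = M i j + N i j := fun _ _ _ _ => rfl
  ext ⟨b, β⟩ ⟨c, γ⟩
  -- forward hops, summed against the characters
  have hF : ∑ y : TorusSite 4 2, ∑ z : TorusSite 4 2, ∑ ν : Fin 4, torusChar k y * torusChar k' z *
      (-(1 / 2 : ℂ) * (if z = Site.shift y ν then ((1 : Matrix (Fin 4) (Fin 4) ℂ) - euclideanGamma ν) β γ *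
        (Complex.exp (↑(θ ν) * I) * E (y, ν) b c) else 0)) =
      ∑ ν : Fin 4, -(1 / 2 : ℂ) * Complex.exp (↑(mom k' ν) * I) *
        ((∑ y, torusChar (k + k') y * E (y, ν) b c) *
          ((1 : Matrix (Fin 4) (Fin 4) ℂ) - euclideanGamma ν) β γ) := by
    refine (Finset.sum_congr rfl fun y _ => Finset.sum_comm).trans ?_
    rw [Finset.sum_comm]
    refine Finset.sum_congr rfl fun ν _ => ?_
    simp_rw [mul_ite, mul_zero, Finset.sum_ite_eq', Finset.mem_univ, if_true]
    rw [Finset.sum_mul, Finset.mul_sum]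
    refine Finset.sum_congr rfl fun y _ => ?_
    rw [Literature.MathematicalPhysics.QuantumFieldTheory.Site.shift, torusChar_add_right,
      LaurentSymbol.torusChar_add_left, ← hfw k' ν]
    ring
  -- backward hops, summed against the characters
  have hB : ∑ y : TorusSite 4 2, ∑ z : TorusSite 4 2, ∑ ν : Fin 4, torusChar k y * torusChar k' z *
      (-(1 / 2 : ℂ) * (if y = Site.shift z ν then ((1 : Matrix (Fin 4) (Fin 4) ℂ) + euclideanGamma ν) β γ *
        (star (Complex.exp (↑(θ ν) * I)) * (E (z, ν))ᴴ b c) else 0)) =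
      ∑ ν : Fin 4, -(1 / 2 : ℂ) * Complex.exp (-(↑(mom k ν) * I)) *
        ((∑ z, torusChar (k + k') z * (E (z, ν))ᴴ b c) *
          ((1 : Matrix (Fin 4) (Fin 4) ℂ) + euclideanGamma ν) β γ) := by
    rw [Finset.sum_comm]
    refine (Finset.sum_congr rfl fun z _ => Finset.sum_comm).trans ?_
    rw [Finset.sum_comm]
    refine Finset.sum_congr rfl fun ν _ => ?_
    simp_rw [mul_ite, mul_zero, Finset.sum_ite_eq', Finset.mem_univ, if_true]
    rw [Finset.sum_mul, Finset.mul_sum]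
    refine Finset.sum_congr rfl fun z _ => ?_
    rw [Literature.MathematicalPhysics.QuantumFieldTheory.Site.shift, torusChar_add_right,
      LaurentSymbol.torusChar_add_left, ← hbw k ν]
    ring
  rw [hhat]
  simp only [hYhH]
  simp only [Matrix.sum_apply, Matrix.smul_apply, Matrix.of_apply, hadd, hDl, hu',
    Matrix.kronecker_apply, smul_eq_mul, Complex.ofReal_mul, hct, hYh, Matrix.conjTranspose_smul]
  simp only [Finset.mul_sum, mul_add, Finset.sum_add_distrib]
  rw [hF, hB]

end Hop

/-! ### Generic pieces for the assembly of the block Hessian -/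

/-- Re-indexing the double momentum sum by the Walsh transfer `s = k + k'` (so `k' = k + s`). -/
theorem sum_reindex {α : Type*} [AddCommMonoid α] (F : (Fin 4 → ZMod 2) → (Fin 4 → ZMod 2) → α) :
    ∑ k, ∑ k', F k k' = ∑ s, ∑ s', F s' (s' + s) := by
  symm
  rw [Finset.sum_comm]
  exact Finset.sum_congr rfl fun k _ => Fintype.sum_equiv (Equiv.addLeft k) _ _ fun s => rfl

/-- `e^{i(x + 2πn)} = e^{ix}`. -/
theorem exp_add_nat_mul_two_pi (x : ℝ) (n : ℕ) :
    Complex.exp (↑(x + n * (2 * Real.pi)) * I) = Complex.exp (↑x * I) := by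
  push_cast
  rw [add_mul, Complex.exp_add, show (n : ℂ) * (2 * Real.pi) * I = n * (2 * Real.pi * I) by ring,
    Complex.exp_nat_mul_two_pi_mul_I, mul_one]

/-- Colour ⊗ spin traces: `tr ((1 ⊗ S)(Σ_ν A_ν ⊗ V_ν)(1 ⊗ S')(Σ_μ B_μ ⊗ W_μ)) = Σ_μ Σ_ν tr (A_ν B_μ) tr (S V_ν S' W_μ)`. -/
theorem trace_kron_two (S₁ S₂ : Matrix (Fin 4) (Fin 4) ℂ) (A B : Fin 4 → Matrix (Fin 3) (Fin 3) ℂ)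
    (V W : Fin 4 → Matrix (Fin 4) (Fin 4) ℂ) :
    ((1 : Matrix (Fin 3) (Fin 3) ℂ) ⊗ₖ S₁ * (∑ ν, A ν ⊗ₖ V ν) *
        ((1 : Matrix (Fin 3) (Fin 3) ℂ) ⊗ₖ S₂ * ∑ μ, B μ ⊗ₖ W μ)).trace =
      ∑ μ, ∑ ν, (A ν * B μ).trace * (S₁ * V ν * (S₂ * W μ)).trace := by
  simp only [Matrix.mul_sum, Matrix.sum_mul, Matrix.trace_sum, ← Matrix.mul_kronecker_mul,
    Matrix.one_mul, Matrix.trace_kronecker]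

/-- Colour ⊗ spin traces: `tr ((1 ⊗ S)(Σ_ν A_ν ⊗ V_ν)) = Σ_ν tr A_ν · tr (S V_ν)`. -/
theorem trace_kron_one (S₁ : Matrix (Fin 4) (Fin 4) ℂ) (A : Fin 4 → Matrix (Fin 3) (Fin 3) ℂ)
    (V : Fin 4 → Matrix (Fin 4) (Fin 4) ℂ) :
    ((1 : Matrix (Fin 3) (Fin 3) ℂ) ⊗ₖ S₁ * ∑ ν, A ν ⊗ₖ V ν).trace = ∑ ν, (A ν).trace * (S₁ * V ν).trace := by
  simp only [Matrix.mul_sum, Matrix.trace_sum, ← Matrix.mul_kronecker_mul, Matrix.one_mul,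
    Matrix.trace_kronecker]

/-- `A ⊗ (aG + cG') = a (A ⊗ G) + c (A ⊗ G')`. -/
theorem kron_smul_add (A : Matrix (Fin 3) (Fin 3) ℂ) (a c : ℂ) (G G' : Matrix (Fin 4) (Fin 4) ℂ) :
    A ⊗ₖ (a • G + c • G') = a • (A ⊗ₖ G) + c • (A ⊗ₖ G') := by
  rw [Matrix.kronecker_add, Matrix.kronecker_smul, Matrix.kronecker_smul]

/-- Real-part bookkeeping for the bubble: with `G` real,
`Re[(1/256) Σ_{s,s',μ,ν} G τ]/2 = (1/256) Σ_{s,μ,ν} (½ Re Σ_{s'} τ) · Re G`. -/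
theorem re_bubble_bookkeeping (G : (Fin 4 → ZMod 2) → Fin 4 → Fin 4 → ℂ)
    (τ : (Fin 4 → ZMod 2) → (Fin 4 → ZMod 2) → Fin 4 → Fin 4 → ℂ) (hG : ∀ s μ ν, (G s μ ν).im = 0) :
    ((1 / 256 : ℂ) * ∑ s, ∑ s', ∑ μ, ∑ ν, G s μ ν * τ s s' μ ν).re / 2 =
      (1 / 256 : ℝ) * ∑ s, ∑ μ, ∑ ν, ((1 / 2 : ℝ) * (∑ s', τ s s' μ ν).re) * (G s μ ν).re := by
  have hsw : ∀ s, ∑ s', ∑ μ, ∑ ν, G s μ ν * τ s s' μ ν = ∑ μ, ∑ ν, G s μ ν * ∑ s', τ s s' μ ν := by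
    intro s
    rw [Finset.sum_comm]
    refine Finset.sum_congr rfl fun μ _ => ?_
    rw [Finset.sum_comm]
    refine Finset.sum_congr rfl fun ν _ => ?_
    rw [Finset.mul_sum]
  simp_rw [hsw]
  rw [show (1 / 256 : ℂ) = ((1 / 256 : ℝ) : ℂ) by norm_num, Complex.re_ofReal_mul, mul_div_assoc]
  simp only [Complex.re_sum, Complex.mul_re, hG, zero_mul, sub_zero, Finset.sum_div]
  congr 1
  refine Finset.sum_congr rfl fun s _ => Finset.sum_congr rfl fun μ _ => Finset.sum_congr rfl fun ν _ => ?_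
  ring

/-- Real-part bookkeeping for the tadpole: with `X` real and `Σ_s Re g(s)_{μμ} = −16 Re Z_μ`,
`Re[(1/16) Σ_{k,ν} Z_ν X_{kν}]/2 = −(1/256) Σ_{s,μ,ν} [μ = ν] (½ Σ_{s'} X_{s'μ}) · Re g(s)_{μν}`. -/
theorem re_tadpole_bookkeeping (X : (Fin 4 → ZMod 2) → Fin 4 → ℝ) (Z : Fin 4 → ℂ)
    (g : (Fin 4 → ZMod 2) → Fin 4 → Fin 4 → ℂ) (hZ : ∀ μ, ∑ s, (g s μ μ).re = -(16 * (Z μ).re)) :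
    ((1 / 16 : ℂ) * ∑ k, ∑ ν, Z ν * (X k ν : ℂ)).re / 2 =
      -((1 / 256 : ℝ) * ∑ s, ∑ μ, ∑ ν,
        (if μ = ν then (1 / 2 : ℝ) * ∑ s', X s' μ else 0) * (g s μ ν).re) := by
  have h1 : ∀ (s : Fin 4 → ZMod 2) (μ : Fin 4),
      ∑ ν, (if μ = ν then (1 / 2 : ℝ) * ∑ s', X s' μ else 0) * (g s μ ν).re =
        ((1 / 2 : ℝ) * ∑ s', X s' μ) * (g s μ μ).re := fun s μ => by
    simp only [ite_mul, zero_mul, Finset.sum_ite_eq, Finset.mem_univ, if_true]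
  have h2 : ∑ s : Fin 4 → ZMod 2, ∑ μ : Fin 4, ((1 / 2 : ℝ) * ∑ s', X s' μ) * (g s μ μ).re =
      ∑ μ : Fin 4, ((1 / 2 : ℝ) * ∑ s', X s' μ) * -(16 * (Z μ).re) := by
    rw [Finset.sum_comm]
    refine Finset.sum_congr rfl fun μ _ => ?_
    rw [← Finset.mul_sum, hZ]
  have h3 : ((1 / 16 : ℂ) * ∑ k, ∑ ν, Z ν * (X k ν : ℂ)).re = (1 / 16 : ℝ) * ∑ ν, ∑ k, (Z ν).re * X k ν := by
    rw [show (1 / 16 : ℂ) = ((1 / 16 : ℝ) : ℂ) by norm_num, Complex.re_ofReal_mul, Complex.re_sum,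
      Finset.sum_comm]
    simp only [Complex.re_sum, Complex.re_mul_ofReal]
  simp_rw [h1]
  rw [h2, h3]
  simp only [Finset.mul_sum, Finset.sum_mul, Finset.sum_div, ← Finset.sum_neg_distrib]
  refine Finset.sum_congr rfl fun ν _ => Finset.sum_congr rfl fun k _ => ?_
  ring

end BlockHessianFormula

open BlockHessianFormula in
/-- **Aux stub `stub_blockHessianFormulaAuxB`** (momentum blocks of the hopping perturbation): on the `2⁴`
block with constant central phases `u_μ = e^{iθ_μ}·1`, for every matrix-valued link field `E` and block
momenta `k, k'`, `Δ̂(E)(k,k') = Σ_ν [ −½ e^{iP_{k'}ν} Ê_ν(k+k') ⊗ (1 − γ_ν) − ½ e^{−iP_k ν} Ê_ν(k+k')ᴴ ⊗ (1 + γ_ν) ]`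
(`Ê_ν(t) = Σ_x χ_t(x) E(x,ν)`, `χ_s(x) = (−1)^{s·x}`, `P_k = θ + πk`). -/
theorem stub_blockHessianFormulaAuxB : ∀ (θ : Fin 4 → ℝ) (u : Fin 4 → Matrix.unitaryGroup (Fin 3) ℂ), (∀ μ, ((u μ : Matrix.unitaryGroup (Fin 3) ℂ) : Matrix (Fin 3) (Fin 3) ℂ) = Complex.exp (↑(θ μ) * Complex.I) • (1 : Matrix (Fin 3) (Fin 3) ℂ)) → let Dl : (Edge 4 2 → Matrix (Fin 3) (Fin 3) ℂ) → Matrix (TorusSite 4 2 × Fin 3 × Fin 4) (TorusSite 4 2 × Fin 3 × Fin 4) ℂ := fun E => Matrix.of fun p q => -(1 / 2 : ℂ) * ∑ μ : Fin 4, ((if q.1 = Site.shift p.1 μ then ((1 : Matrix (Fin 4) (Fin 4) ℂ) - euclideanGamma μ) p.2.2 q.2.2 * (((u μ : Matrix.unitaryGroup (Fin 3) ℂ) : Matrix (Fin 3) (Fin 3) ℂ) * E (p.1, μ)) p.2.1 q.2.1 else 0) + (if p.1 = Site.shift q.1 μ then ((1 : Matrix (Fin 4) (Fin 4) ℂ)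 + euclideanGamma μ) p.2.2 q.2.2 * (((u μ : Matrix.unitaryGroup (Fin 3) ℂ) : Matrix (Fin 3) (Fin 3) ℂ) * E (q.1, μ))ᴴ p.2.1 q.2.1 else 0)); let mom : (Fin 4 → ZMod 2) → (Fin 4 → ℝ) := fun s κ => θ κ + Real.pi * ((s κ).val : ℝ); let chi : (Fin 4 → ZMod 2) → TorusSite 4 2 → ℝ := fun s x => (-1 : ℝ) ^ (∑ κ : Fin 4, (s κ).val * (x κ).val); let Yh : (Edge 4 2 → Matrix (Fin 3) (Fin 3) ℂ) → (Fin 4 → ZMod 2) → Fin 4 → Matrix (Fin 3) (Fin 3) ℂ := fun Y s μ => ∑ x : TorusSite 4 2, ((chi s x : ℝ) : ℂ) • Y (x, μ); let hat : Matrix (TorusSite 4 2 × Fin 3 × Fin 4) (TorusSite 4 2 × Fin 3 × Fin 4) ℂ → (Fin 4 → ZMod 2) → (Fin 4 → ZMod 2) → Matrix (Fin 3 × Fin 4) (Fin 3 × Fin 4) ℂ := fun A k k' => ∑ y : TorusSite 4 2, ∑ z : TorusSite 4 2, ((chi k y * chi k' z : ℝ) : ℂ) • Matrix.of (fun c c'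 : Fin 3 × Fin 4 => A (y, c) (z, c')); ∀ (E : Edge 4 2 → Matrix (Fin 3) (Fin 3) ℂ) (k k' : Fin 4 → ZMod 2), hat (Dl E) k k' = ∑ ν : Fin 4, ((-(1 / 2 : ℂ) * Complex.exp (↑(mom k' ν) * Complex.I)) • Matrix.kroneckerMap (fun a b => a * b) (Yh E (k + k') ν) ((1 : Matrix (Fin 4) (Fin 4) ℂ) - euclideanGamma ν) + (-(1 / 2 : ℂ) * Complex.exp (-(↑(mom k ν) * Complex.I))) • Matrix.kroneckerMap (fun a b => a * b) ((Yh E (k + k') ν)ᴴ) ((1 : Matrix (Fin 4) (Fin 4) ℂ) + euclideanGamma ν)) := by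
  intro θ u hu Dl mom chi Yh hat E k k'
  exact hat_hop θ u Dl mom chi Yh hat hu (fun _ => rfl) (fun _ _ => rfl) (fun _ _ => rfl) (fun _ _ _ => rfl)
    (fun _ _ _ => rfl) E k k'

end Summit.QuantumFields.QCD.Cruxes.CriticalLineDiamagnetism.ChessboardCellGain

end
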